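import Mathlib
import Summits.PneNP.PneNP.Theorems.Nc03AvoidResidualCoreReductionBfsP2
import Summits.PneNP.PneNP.Theorems.Nc03AvoidResidualCoreReductionFcycB

/-!
# Route Nc03AvoidResidualCore, item `ResidualCoreReduction` — the solver, XI: the fundamental cycle as a program

Helper file for `stmt-PneNP-20227` (sequel of `…ReductionBfsP2`; cell pnp-ideate). List-level
counterparts of the fundamental cycle of a non-forest edge (`…ReductionFcyc`, `…ReductionFcycB`):
the capped ranges and ancestor iteration (`rngP`, `ancC`; loop counts must be unary, so every
natural-number count is capped by `2K + 2`, which is harmless on genuine data), the first meeting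
height `kbP`, `lcaP`, `kaP`, the cycle length `clenP`, the edge sequence `cycP`, the edge list
`fcycListP` and the alternating pattern `fcolP`; agreement with `Bip.kb/lca/ka/clen/cyc/fcycle/fcol`
on genuine data, and polynomial time.
-/

set_option linter.dupNamespace false -- `Summit.PneNP.PneNP.…`: summit = sub-problem name (D-0017 single-conjunct layout)

namespace Summit.PneNP.PneNP.Theorems.Nc03Reduction

open Literature.Computability.Complexity CodeFP

/-! ## Programs -/

/-- The cap for loop counts: `2K + 2`. -/
def capP (gd : GD) : ℕ := 2 * gd.1 + 2

/-- A capped range. -/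
def rngP (gd : GD) (n : ℕ) : List ℕ := List.range (min n (capP gd))

/-- Capped ancestors. -/
def ancC (gd : GD) (E : List Bool) (k w : ℕ) : ℕ := ancP gd E (min k (capP gd)) w

/-- The A-endpoint of edge `e`. -/
def aP (gd : GD) (e : ℕ) : ℕ := (entryP gd e).2.1
/-- The B-endpoint of edge `e`. -/
def bP (gd : GD) (e : ℕ) : ℕ := (entryP gd e).2.2

/-- The meeting test at height `i` on the B-chain. -/
def mergeTestP (gd : GD) (E : List Bool) (e i : ℕ) : Bool :=
  (rngP gd (depthP gd E (aP gd e) + 1)).any fun m =>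
    decide (ancC gd E i (bP gd e) = ancC gd E m (aP gd e))

/-- The first meeting height. -/
def kbP (gd : GD) (E : List Bool) (e : ℕ) : ℕ :=
  ((rngP gd (depthP gd E (bP gd e) + 1)).find? fun i => mergeTestP gd E e i).getD 0

/-- The first common ancestor. -/
def lcaP (gd : GD) (E : List Bool) (e : ℕ) : ℕ := ancC gd E (kbP gd E e) (bP gd e)

/-- The meeting height on the A-side. -/
def kaP (gd : GD) (E : List Bool) (e : ℕ) : ℕ := depthP gd E (aP gd e) - depthP gd E (lcaP gd E e)

/-- The cycle length. -/
def clenP (gd : GD) (E : List Bool) (e : ℕ) : ℕ := kbP gd E e + kaP gd E e + 1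

/-- The `i`-th edge of the cycle. -/
def cycP (gd : GD) (E : List Bool) (e i : ℕ) : ℕ :=
  if decide (i = 0) then e
  else if decide (i ≤ kbP gd E e) then peP gd E (ancC gd E (i - 1) (bP gd e))
  else peP gd E (ancC gd E (kbP gd E e + kaP gd E e - i) (aP gd e))

/-- The edges of the cycle, listed. -/
def fcycListP (gd : GD) (E : List Bool) (e : ℕ) : List ℕ := (rngP gd (clenP gd E e)).map fun i => cycP gd E e i

/-- The alternating pattern of the cycle: `true` on even-position edges. -/
def fcolP (gd : GD) (E : List Bool) (e j : ℕ) : Bool :=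
  (rngP gd (clenP gd E e)).any fun i => decide (i % 2 = 0) && decide (cycP gd E e i = j)

/-! ## Agreement with `Bip` -/

section Bridge

variable {M K : ℕ} {G : Bip (Fin M) (Fin K)} {S : Finset (Fin M)} {E : List Bool}

/-- The cap of genuine data. -/
@[simp] theorem capP_gdOf : capP (gdOf G) = 2 * K + 2 := rfl

/-- Endpoints of a genuine edge. -/
theorem aP_eq (e : Fin M) : aP (gdOf G) e.val = (G.eA e).val := by unfold aP; rw [entryP_eq]
/-- Endpoints of a genuine edge. -/
theorem bP_eq (e : Fin M) : bP (gdOf G) e.val = (G.eB e).val := by unfold bP; rw [entryP_eq]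

variable [NeZero M]

/-- Capped ancestors within the cap. -/
theorem ancC_eq (hE : RepE S E) {k : ℕ} (hk : k ≤ 2 * K + 1) (w : Fin K) :
    ancC (gdOf G) E k w.val = (G.anc S k w).val := by
  unfold ancC; rw [capP_gdOf, min_eq_left (by omega), ancP_eq hE]

/-- Reading the meeting test (for heights within the depth of the B-endpoint). -/
theorem mergeTestP_iff (hE : RepE S E) (e : Fin M) {i : ℕ} (hi : i ≤ G.depth S (G.eB e)) :
    mergeTestP (gdOf G) E e.val i = true ↔
      ∃ m, m ≤ G.depth S (G.eA e) ∧ G.anc S i (G.eB e) = G.anc S m (G.eA e) := by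
  have hdb := depth_le_K (G := G) (S := S) (G.eB e)
  have hda := depth_le_K (G := G) (S := S) (G.eA e)
  unfold mergeTestP rngP
  rw [aP_eq, bP_eq, depthP_eq hE, capP_gdOf, min_eq_left (by omega), List.any_eq_true]
  simp only [List.mem_range, decide_eq_true_eq, Nat.lt_succ_iff]
  constructor
  · rintro ⟨m, hm, h⟩
    rw [ancC_eq hE (by omega), ancC_eq hE (by omega)] at h
    exact ⟨m, hm, Fin.ext h⟩
  · rintro ⟨m, hm, h⟩
    refine ⟨m, hm, ?_⟩
    rw [ancC_eq hE (by omega), ancC_eq hE (by omega), h]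

/-- **First meeting height**: agreement with `Bip.kb`. -/
theorem kbP_eq (hE : RepE S E) {e : Fin M} (he : e ∈ S) : kbP (gdOf G) E e.val = G.kb S e := by
  obtain ⟨hkb, hex, hmin⟩ := G.kb_spec he
  have hdb := depth_le_K (G := G) (S := S) (G.eB e)
  unfold kbP rngP
  rw [bP_eq, depthP_eq hE, capP_gdOf, min_eq_left (by omega),
    find?_range_eq_some (p := fun i => mergeTestP (gdOf G) E e.val i) (m := G.kb S e) (by omega)
      ((mergeTestP_iff hE e hkb).2 hex) fun i hi => ?_]
  · rfl
  · cases h : mergeTestP (gdOf G) E e.val i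
    · rfl
    · exfalso
      obtain ⟨m, hm, heq⟩ := (mergeTestP_iff hE e (by omega)).1 h
      exact hmin i hi m hm heq

/-- **First common ancestor**: agreement with `Bip.lca`. -/
theorem lcaP_eq (hE : RepE S E) {e : Fin M} (he : e ∈ S) : lcaP (gdOf G) E e.val = (G.lca S e).val := by
  have hkb := (G.kb_spec he).1
  have hdb := depth_le_K (G := G) (S := S) (G.eB e)
  unfold lcaP Bip.lca
  rw [kbP_eq hE he, bP_eq, ancC_eq hE (by omega)]

/-- **A-side height**: agreement with `Bip.ka`. -/
theorem kaP_eq (hE : RepE S E) {e : Fin M} (he : e ∈ S) : kaP (gdOf G) E e.val = G.ka S e := by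
  unfold kaP Bip.ka
  rw [aP_eq, depthP_eq hE, lcaP_eq hE he, depthP_eq hE]

/-- **Cycle length**: agreement with `Bip.clen`. -/
theorem clenP_eq (hE : RepE S E) {e : Fin M} (he : e ∈ S) : clenP (gdOf G) E e.val = G.clen S e := by
  unfold clenP Bip.clen; rw [kbP_eq hE he, kaP_eq hE he]

/-- The cycle length is within the cap. -/
theorem clen_le {e : Fin M} (he : e ∈ S) : G.clen S e ≤ 2 * K + 1 := by
  have h1 := (G.kb_spec he).1
  have h2 := (G.anc_ka he).2
  have h3 := depth_le_K (G := G) (S := S) (G.eB e)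
  have h4 := depth_le_K (G := G) (S := S) (G.eA e)
  unfold Bip.clen; omega

/-- **Cycle edges**: agreement with `Bip.cyc` (below the cycle length). -/
theorem cycP_eq (hE : RepE S E) {e : Fin M} (he : e ∈ S) {i : ℕ} (hi : i < G.clen S e) :
    cycP (gdOf G) E e.val i = (G.cyc S e i).val := by
  have hkb := (G.kb_spec he).1
  have hka := (G.anc_ka he).2
  have hdb := depth_le_K (G := G) (S := S) (G.eB e)
  have hda := depth_le_K (G := G) (S := S) (G.eA e)
  unfold cycP Bip.cyc
  rw [kbP_eq hE he, kaP_eq hE he, aP_eq, bP_eq]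
  simp only [decide_eq_true_eq]
  unfold Bip.clen at hi
  split_ifs with h0 h1
  · rfl
  · rw [ancC_eq hE (by omega), peP_eq hE]
  · rw [ancC_eq hE (by omega), peP_eq hE]

/-- **Cycle edge list**: its members are the members of `Bip.fcycle`. -/
theorem mem_fcycListP (hE : RepE S E) {e : Fin M} (he : e ∈ S) (j : Fin M) :
    j.val ∈ fcycListP (gdOf G) E e.val ↔ j ∈ G.fcycle S e := by
  unfold fcycListP rngP
  rw [clenP_eq hE he, capP_gdOf, min_eq_left (by have := clen_le (G := G) he; omega), G.mem_fcycle he,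
    List.mem_map]
  simp only [List.mem_range]
  constructor
  · rintro ⟨i, hi, h⟩; exact ⟨i, hi, Fin.ext (by rw [← cycP_eq hE he hi, h])⟩
  · rintro ⟨i, hi, h⟩; exact ⟨i, hi, by rw [cycP_eq hE he hi, h]⟩

/-- **Alternating pattern**: agreement with `Bip.fcol`. -/
theorem fcolP_eq (hE : RepE S E) {e : Fin M} (he : e ∈ S) (j : Fin M) :
    fcolP (gdOf G) E e.val j.val = G.fcol S e j := by
  have h2 := G.two_hl he
  unfold fcolP rngP Bip.fcol Bip.fte
  rw [clenP_eq hE he, capP_gdOf, min_eq_left (by have := clen_le (G := G) he; omega)]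
  apply Bool.eq_iff_iff.2
  rw [List.any_eq_true, decide_eq_true_eq, Finset.mem_image]
  simp only [List.mem_range, Bool.and_eq_true, decide_eq_true_eq, Finset.mem_range]
  constructor
  · rintro ⟨i, hi, hev, h⟩
    refine ⟨i / 2, by omega, Fin.ext ?_⟩
    rw [show 2 * (i / 2) = i by omega, ← cycP_eq hE he hi, h]
  · rintro ⟨k, hk, h⟩
    exact ⟨2 * k, by omega, by omega, by rw [cycP_eq hE he (by omega), h]⟩

end Bridge

/-! ## Polynomial time -/

/-- The cap is polynomial time (in unary). -/
theorem codeFP_capP : CodeFP gdE unE capP :=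
  ((unAdd.comp (((unMulConst 2).comp (fst _ _)).pair (const _ 2))).congr fun gd => by
    show 2 * gd.1 + 2 = capP gd; rfl)

/-- Capped ranges are polynomial time. -/
theorem codeFP_rngP : CodeFP (pairE gdE natE) (rawE natE) (fun q => rngP q.1 q.2) :=
  (urange.comp (unOfNatMin.comp ((codeFP_capP.comp (fst _ _)).pair (snd _ _)))).congr fun _ => rfl

/-- Capped ancestors are polynomial time. -/
theorem codeFP_ancC : CodeFP (pairE ceE (pairE natE natE)) natE (fun q => ancC q.1.1 q.1.2 q.2.1 q.2.2) :=
  (codeFP_ancP.comp ((fst _ _).pair ((unOfNatMin.comp ((codeFP_capP.comp (fst _ _).fst').pair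
    (snd _ _).fst')).pair (snd _ _).snd'))).congr fun _ => rfl

/-- The A-endpoint is polynomial time. -/
theorem codeFP_aP : CodeFP (pairE gdE natE) natE (fun q => aP q.1 q.2) := (codeFP_entryP.snd'.fst').congr fun _ => rfl
/-- The B-endpoint is polynomial time. -/
theorem codeFP_bP : CodeFP (pairE gdE natE) natE (fun q => bP q.1 q.2) := (codeFP_entryP.snd'.snd').congr fun _ => rfl

/-- Context code `(ce, e)`. -/
abbrev ceeE : (GD × List Bool) × ℕ → List Bool := pairE ceE natE

/-- The meeting test is polynomial time. -/
theorem codeFP_mergeTestP : CodeFP (pairE ceeE natE) bitE (fun q => mergeTestP q.1.1.1 q.1.1.2 q.1.2 q.2) := by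
  -- context `((ce, e), i)`, item `m`
  have ha : CodeFP (pairE (pairE ceeE natE) natE) natE (fun y => aP y.1.1.1.1 y.1.1.2) :=
    (codeFP_aP.comp ((fst _ _).fst'.fst'.fst'.pair (fst _ _).fst'.snd')).congr fun _ => rfl
  have hb : CodeFP (pairE (pairE ceeE natE) natE) natE (fun y => bP y.1.1.1.1 y.1.1.2) :=
    (codeFP_bP.comp ((fst _ _).fst'.fst'.fst'.pair (fst _ _).fst'.snd')).congr fun _ => rfl
  have hce : CodeFP (pairE (pairE ceeE natE) natE) ceE (fun y => y.1.1.1) := (fst _ _).fst'.fst'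
  have h1 : CodeFP (pairE (pairE ceeE natE) natE) natE (fun y => ancC y.1.1.1.1 y.1.1.1.2 y.1.2 (bP y.1.1.1.1 y.1.1.2)) :=
    (codeFP_ancC.comp (hce.pair ((fst _ _).snd'.pair hb))).congr fun _ => rfl
  have h2 : CodeFP (pairE (pairE ceeE natE) natE) natE (fun y => ancC y.1.1.1.1 y.1.1.1.2 y.2 (aP y.1.1.1.1 y.1.1.2)) :=
    (codeFP_ancC.comp (hce.pair ((snd _ _).pair ha))).congr fun _ => rfl
  have hp : CodeFP (pairE (pairE ceeE natE) natE) bitE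
      (fun y => decide (ancC y.1.1.1.1 y.1.1.1.2 y.1.2 (bP y.1.1.1.1 y.1.1.2) = ancC y.1.1.1.1 y.1.1.1.2 y.2 (aP y.1.1.1.1 y.1.1.2))) :=
    codeFP_eqTest h1 h2
  have hda : CodeFP (pairE ceeE natE) natE (fun q => depthP q.1.1.1 q.1.1.2 (aP q.1.1.1 q.1.2) + 1) :=
    (natAdd.comp ((codeFP_depthP.comp ((fst _ _).fst'.pair (codeFP_aP.comp ((fst _ _).fst'.fst'.pair (fst _ _).snd')))).pair
      (const _ 1))).congr fun _ => rfl
  have hr : CodeFP (pairE ceeE natE) (rawE natE) (fun q => rngP q.1.1.1 (depthP q.1.1.1 q.1.1.2 (aP q.1.1.1 q.1.2) + 1)) :=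
    (codeFP_rngP.comp ((fst _ _).fst'.fst'.pair hda)).congr fun _ => rfl
  exact ((any hp).comp ((CodeFP.id _).pair hr)).congr fun _ => rfl

/-- The first meeting height is polynomial time. -/
theorem codeFP_kbP : CodeFP ceeE natE (fun q => kbP q.1.1 q.1.2 q.2) := by
  have hp : CodeFP (pairE ceeE natE) bitE (fun y => mergeTestP y.1.1.1 y.1.1.2 y.1.2 y.2) := codeFP_mergeTestP
  have hdb : CodeFP ceeE natE (fun q => depthP q.1.1 q.1.2 (bP q.1.1 q.2) + 1) :=
    (natAdd.comp ((codeFP_depthP.comp ((fst _ _).pair (codeFP_bP.comp ((fst _ _).fst'.pair (snd _ _))))).pair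
      (const _ 1))).congr fun _ => rfl
  have hr : CodeFP ceeE (rawE natE) (fun q => rngP q.1.1 (depthP q.1.1 q.1.2 (bP q.1.1 q.2) + 1)) :=
    (codeFP_rngP.comp ((fst _ _).fst'.pair hdb)).congr fun _ => rfl
  have hf : CodeFP ceeE (optE natE) (fun q => (rngP q.1.1 (depthP q.1.1 q.1.2 (bP q.1.1 q.2) + 1)).find?
      fun i => mergeTestP q.1.1 q.1.2 q.2 i) := ((rawFind? hp).comp ((CodeFP.id _).pair hr)).congr fun _ => rfl
  exact ((optGetD natE).comp (hf.pair (const _ 0))).congr fun _ => rfl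

/-- The first common ancestor is polynomial time. -/
theorem codeFP_lcaP : CodeFP ceeE natE (fun q => lcaP q.1.1 q.1.2 q.2) :=
  (codeFP_ancC.comp ((fst _ _).pair (codeFP_kbP.pair (codeFP_bP.comp ((fst _ _).fst'.pair (snd _ _)))))).congr
    fun _ => rfl

/-- The A-side height is polynomial time. -/
theorem codeFP_kaP : CodeFP ceeE natE (fun q => kaP q.1.1 q.1.2 q.2) := by
  have hda : CodeFP ceeE natE (fun q => depthP q.1.1 q.1.2 (aP q.1.1 q.2)) :=
    (codeFP_depthP.comp ((fst _ _).pair (codeFP_aP.comp ((fst _ _).fst'.pair (snd _ _))))).congr fun _ => rfl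
  have hdl : CodeFP ceeE natE (fun q => depthP q.1.1 q.1.2 (lcaP q.1.1 q.1.2 q.2)) :=
    (codeFP_depthP.comp ((fst _ _).pair codeFP_lcaP)).congr fun _ => rfl
  exact (natSub.comp (hda.pair hdl)).congr fun _ => rfl

/-- The cycle length is polynomial time. -/
theorem codeFP_clenP : CodeFP ceeE natE (fun q => clenP q.1.1 q.1.2 q.2) :=
  (natAdd.comp ((natAdd.comp (codeFP_kbP.pair codeFP_kaP)).pair (const _ 1))).congr fun _ => rfl

/-- The cycle edges are polynomial time. -/
theorem codeFP_cycP : CodeFP (pairE ceeE natE) natE (fun q => cycP q.1.1.1 q.1.1.2 q.1.2 q.2) := by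
  have hce : CodeFP (pairE ceeE natE) ceE (fun q => q.1.1) := (fst _ _).fst'
  have he : CodeFP (pairE ceeE natE) natE (fun q => q.1.2) := (fst _ _).snd'
  have hi : CodeFP (pairE ceeE natE) natE (fun q => q.2) := snd _ _
  have hkb : CodeFP (pairE ceeE natE) natE (fun q => kbP q.1.1.1 q.1.1.2 q.1.2) := codeFP_kbP.comp (fst _ _)
  have hka : CodeFP (pairE ceeE natE) natE (fun q => kaP q.1.1.1 q.1.1.2 q.1.2) := codeFP_kaP.comp (fst _ _)
  have ha : CodeFP (pairE ceeE natE) natE (fun q => aP q.1.1.1 q.1.2) := (codeFP_aP.comp (hce.fst'.pair he)).congr fun _ => rfl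
  have hb : CodeFP (pairE ceeE natE) natE (fun q => bP q.1.1.1 q.1.2) := (codeFP_bP.comp (hce.fst'.pair he)).congr fun _ => rfl
  have hbr1 : CodeFP (pairE ceeE natE) natE (fun q => peP q.1.1.1 q.1.1.2 (ancC q.1.1.1 q.1.1.2 (q.2 - 1) (bP q.1.1.1 q.1.2))) :=
    (codeFP_peP.comp (hce.pair (codeFP_ancC.comp (hce.pair ((natSub.comp (hi.pair (const _ 1))).pair hb))))).congr
      fun _ => rfl
  have hbr2 : CodeFP (pairE ceeE natE) natE (fun q => peP q.1.1.1 q.1.1.2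
      (ancC q.1.1.1 q.1.1.2 (kbP q.1.1.1 q.1.1.2 q.1.2 + kaP q.1.1.1 q.1.1.2 q.1.2 - q.2) (aP q.1.1.1 q.1.2))) :=
    (codeFP_peP.comp (hce.pair (codeFP_ancC.comp (hce.pair ((natSub.comp ((natAdd.comp (hkb.pair hka)).pair hi)).pair
      ha))))).congr fun _ => rfl
  exact (CodeFP.ite (codeFP_eqTest hi (const _ 0)) he
    (CodeFP.ite ((natLe.comp (hi.pair hkb)).congr fun _ => rfl) hbr1 hbr2)).congr fun _ => rfl

/-- The cycle edge list is polynomial time. -/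
theorem codeFP_fcycListP : CodeFP ceeE (rawE natE) (fun q => fcycListP q.1.1 q.1.2 q.2) := by
  have hr : CodeFP ceeE (rawE natE) (fun q => rngP q.1.1 (clenP q.1.1 q.1.2 q.2)) :=
    (codeFP_rngP.comp ((fst _ _).fst'.pair codeFP_clenP)).congr fun _ => rfl
  exact ((map codeFP_cycP).comp ((CodeFP.id _).pair hr)).congr fun _ => rfl

/-- The alternating pattern is polynomial time. -/
theorem codeFP_fcolP : CodeFP (pairE ceeE natE) bitE (fun q => fcolP q.1.1.1 q.1.1.2 q.1.2 q.2) := by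
  -- context `((ce, e), j)`, item `i`
  have hp : CodeFP (pairE (pairE ceeE natE) natE) bitE
      (fun y => decide (y.2 % 2 = 0) && decide (cycP y.1.1.1.1 y.1.1.1.2 y.1.1.2 y.2 = y.1.2)) :=
    ((codeFP_eqTest (natMod.comp ((snd _ _).pair (const _ 2))) (const _ 0)).and
      (codeFP_eqTest (codeFP_cycP.comp ((fst _ _).fst'.pair (snd _ _))) (fst _ _).snd')).congr fun _ => rfl
  have hr : CodeFP (pairE ceeE natE) (rawE natE) (fun q => rngP q.1.1.1 (clenP q.1.1.1 q.1.1.2 q.1.2)) :=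
    (codeFP_rngP.comp ((fst _ _).fst'.fst'.pair (codeFP_clenP.comp (fst _ _)))).congr fun _ => rfl
  exact ((any hp).comp ((CodeFP.id _).pair hr)).congr fun _ => rfl

end Summit.PneNP.PneNP.Theorems.Nc03Reduction
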